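import Summits.QuantumFields.YangMills.Theorems.BalabanUVNodesN15KingModelRandomWalkFree
import Summits.QuantumFields.YangMills.Theorems.BalabanUVNodesN15KingModelCovariantKatoDomination
import HarnessLib

/-!
# BalabanUVNodes ∕ N15 — THE KING-MODEL RUNG (PART Ͱ-m): KATO DOMINATION ON AN ARBITRARY FINITE GRAPH WITH FREE («NEUMANN») BOUNDARY WEIGHTS — for EVERY hopping datum
# `H = (src, tgt, w ≥ 0, c_x = m² + Σ_{b∋x}w_b)` and every unitary link field `U`: `‖((H.coupling U)⁻¹)_{xy}‖ ≤ ((diag c − t)⁻¹)(x,y)`, `t` the scalar weight matrix — King's regions `Ω`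
# («carry over the results to Ω … with free boundary conditions», [King1986] p.670) and the torus (PART Ͱ-b) as instances (Track A, DAG node N15 = NE2; FAN-OUT v1.1 §N15 s3; count-neutral)

HONEST FRAMING.  Count-neutral (cell `pub-ymgap`, seat `pub-ymgap-dag-n15-e` g42; `--supports stmt-QuantumFields-27247 --as helper` = K3ᴬ, KEY MAP v3).  Finite graphs, minimally coupled
NEAREST-NEIGHBOUR operators only (no block-averaging penalty — PART Ͱ-j certifies that the full `G_k(U)` is out of reach of this route); NOT [B9] (3.42); NOT a node discharge (N15 of
record untouched); nothing continuum ∕ ℝ⁴ ∕ OS ∕ Clay.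

THE RESULT.  Let `H : Hopping ι β` be ANY finite multigraph datum of the tree's `LatticeDiamagneticInequality` (sites `ι`, bonds `β`, `src`, `tgt`, bond weights `w_b ≥ 0`, site weights `c_x`)
satisfying the FREE-BOUNDARY («Neumann») convention `c_x = m² + rowSum_x` (`rowSum_x = Σ_{b : src b = x}w_b + Σ_{b : tgt b = x}w_b`) with `m² > 0` — e.g. King's torus datum
(`kingHopping`, Ͱ-a: `rowSum ≡ 2(d+1)c`), or the bonds INSIDE a region `Ω` of the torus (King's `Ω` with free boundary conditions, p.670; Bałaban's `Λ`).  Then for every fibre `𝕜ⁿ` and EVERY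
unitary link field `U : β → U(n)`, with `M_U = H.coupling U` (`⟨v,M_Uv⟩ = Σ_bw_b|U_bv_{tgt b} − v_{src b}|² + m²‖v‖²`) and the SCALAR COMPARISON OPERATOR `M₀ = diag(c) − t`
(`t = H.weightMatrix`, the `n = 1`, `U ≡ 1` shadow):
* §1 slots (`graphNbr`, `graphW`, `graphT`, `gfib`), `sum_graphW` (`= rowSum`), `graphT` contractions, ★ `gfib_eq_of_coupling_mulVec` (the covariant equation in Kato form, via Ͱ-a
  `placed_mulVec_apply`), `scalarCoupling`, ★ `scalar_eq_of_scalarCoupling_mulVec`;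
* §2 ★ `scalarCoupling_mulVec_injective` ∕ `isUnit_scalarCoupling` (by the tree's `eq_zero_of_resolvent_zero` — no spectral input), `isUnit_coupling` (tree `posDef_coupling`),
  ★★★ **`norm_gfib_coupling_inv_mulVec_le`** — `‖f_x‖ ≤ g_x ∀x ⟹ ‖(M_U⁻¹f)_x‖ ≤ (M₀⁻¹g)_x` (the tree's `norm_le_scalar_of_resolvent` on the slots), `scalarCoupling_inv_nonneg`,
  ★★★ **`norm_blk_coupling_inv_mulVec_le`** ∕ ★★★ **`norm_coupling_inv_entry_le`** (`|M_U⁻¹((x,i),(y,j))| ≤ M₀⁻¹(x,y)`), ★★ **`norm_gfib_coupling_inv_mulVec_le_div_mass`** (`≤ sup‖f‖∕m²`);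
* §3 the torus instance recovered: `weightMatrix_kingHopping` (`= kingHop K c`, Ͱ-k), ★ `scalarCoupling_kingHopping` (`= lapF K c m²`), so §2 at `H = kingHopping` is PART Ͱ-b's
  `norm_inv_entry_le_lapF_inv` (consistency, `norm_covLapF_inv_entry_le_again`).

PRIOR TREE ART (by name): `LatticeDiamagneticInequality.Hopping` (`coupling`, `hop`, `weightMatrix`, `rowSum`, `StrictDom`, `posDef_coupling`, `placed`, `blk`), `B9Eq323KatoDomination`
(`norm_le_scalar_of_resolvent`, `norm_le_of_resolvent`, `eq_zero_of_resolvent_zero`, `scalar_nonneg_of_resolvent`), Ͱ-a (`placed_mulVec_apply`, `kingHopping`, `kingHopping_rowSum`, `covLapF`),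
Ͱ-b (`norm_toEuclideanLin_of_mem_unitaryGroup`, `norm_inv_entry_le_lapF_inv`), Ͱ-k (`kingHop`, `lapF_eq_sub_kingHop`).  Dedup (rg at filing): basename 0 files; needles
`graphNbr|graphW|graphT|gfib|scalarCoupling|norm_gfib_coupling_inv_mulVec_le|norm_coupling_inv_entry_le` 0 tree files.  Locators: [King1986] §4 p.670 l.8–13, (4.4) p.670;
[Balaban1985BackgroundPropagators] (3.23)∕(3.24) p.394 (operators on subsets `Λ`), (3.42) p.397; [DodziukMathai2006] §1 Lemma 1.1∕1.2, Thm 1.5 (any graph `K`).  0 `sorry`, 5 plumbing `def`s.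
-/

noncomputable section

open scoped BigOperators ComplexConjugate ComplexOrder
open Finset Matrix WithLp

namespace Summit.QuantumFields.YangMills.BalabanUVNodes.N15KingModelRung.Covariant

open Literature.MathematicalPhysics.QuantumFieldTheory.LatticeDiamagneticInequality (Hopping blk placed)
open Literature.MathematicalPhysics.QuantumFieldTheory.Balaban1983to89.B5Prop11Plancherel (Tor unitVec)
open Literature.MathematicalPhysics.QuantumFieldTheory.Balaban1983to89.B9Eq323KatoDomination (norm_le_scalar_of_resolvent norm_le_of_resolvent eq_zero_of_resolvent_zero
  scalar_nonneg_of_resolvent)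
open Literature.MathematicalPhysics.QuantumFieldTheory.King1986.Torus (lapF)

variable {ι β : Type*} {𝕜 : Type*} [RCLike 𝕜] {n : Type*}

/-! ## §1 The slots of a hopping datum and the two equations in Kato form -/

/-- The NEIGHBOUR of `x` through the slot `(b, ±)`: `tgt b` forward, `src b` backward. [folklore] -/
def graphNbr (H : Hopping ι β) (_x : ι) (j : β × Bool) : ι := if j.2 then H.tgt j.1 else H.src j.1

/-- The WEIGHT of the slot `(b, ±)` at `x`: `w_b` if `x` is the source (forward) ∕ target (backward) end of `b`, else `0`. [folklore] -/
def graphW [DecidableEq ι] (H : Hopping ι β) (x : ι) (j : β × Bool) : ℝ :=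
  if j.2 then (if H.src j.1 = x then H.w j.1 else 0) else (if H.tgt j.1 = x then H.w j.1 else 0)

/-- The TRANSPORTER of the slot `(b, ±)`: `U_b` forward, `U_b^*` backward, on `EuclideanSpace 𝕜 n`. [folklore] -/
def graphT [Fintype n] [DecidableEq n] (U : β → Matrix n n 𝕜) (_x : ι) (j : β × Bool) : EuclideanSpace 𝕜 n →ₗ[𝕜] EuclideanSpace 𝕜 n :=
  if j.2 then Matrix.toEuclideanLin (U j.1) else Matrix.toEuclideanLin (U j.1)ᴴ

/-- The FIBRE of `v : ι × n → 𝕜` at `x` in `EuclideanSpace 𝕜 n`. [folklore] -/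
def gfib (v : ι × n → 𝕜) (x : ι) : EuclideanSpace 𝕜 n := toLp 2 fun i => v (x, i)

/-- THE SCALAR COMPARISON OPERATOR `M₀ = diag(c) − t` (`t = weightMatrix`, the `n = 1`, `U ≡ 1` shadow of `H.coupling`). [cite: DodziukMathai2006, Lemma 1.1 §1] -/
def scalarCoupling [Fintype β] [DecidableEq ι] (H : Hopping ι β) : Matrix ι ι ℝ := diagonal H.c - H.weightMatrix

variable [Fintype ι] [Fintype β] [DecidableEq ι] [Fintype n] [DecidableEq n]

omit [Fintype ι] [Fintype n] [DecidableEq n] in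
/-- The slot weights sum to the row sum: `Σ_j graphW x j = rowSum x`. [folklore] -/
theorem sum_graphW (H : Hopping ι β) (x : ι) : ∑ j, graphW H x j = H.rowSum x := by
  rw [Hopping.rowSum, Fintype.sum_prod_type]
  simp only [Fintype.sum_bool, graphW, if_true, Bool.false_eq_true, if_false]

omit [Fintype ι] [Fintype β] [Fintype n] [DecidableEq n] in
/-- The slot weights are non-negative when the bond weights are. [folklore] -/
theorem graphW_nonneg (H : Hopping ι β) (hw : ∀ b, 0 ≤ H.w b) (x : ι) (j : β × Bool) : 0 ≤ graphW H x j := by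
  unfold graphW; split_ifs <;> first | exact hw _ | exact le_rfl

omit [Fintype ι] [Fintype β] [DecidableEq ι] in
/-- The slot transporters of a unitary link field are contractions. [cite: DodziukMathai2006, Lemma 1.2 §1] -/
theorem norm_graphT_le {U : β → Matrix n n 𝕜} (hU : ∀ b, U b ∈ Matrix.unitaryGroup n 𝕜) (x : ι) (j : β × Bool) (w : EuclideanSpace 𝕜 n) : ‖graphT U x j w‖ ≤ ‖w‖ := by
  unfold graphT
  split_ifs
  · exact (norm_toEuclideanLin_of_mem_unitaryGroup (hU _) w).le
  · have h' : (U j.1)ᴴ ∈ Matrix.unitaryGroup n 𝕜 := by simpa only [star_eq_conjTranspose] using Unitary.star_mem (hU _)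
    exact (norm_toEuclideanLin_of_mem_unitaryGroup h' w).le

/-- The hopping matrix on a vector, in slot form: `(T_Uv)_x = Σ_j graphW x j·T_j v_{nbr x j}`. [folklore] -/
theorem gfib_hop_mulVec (H : Hopping ι β) (U : β → Matrix n n 𝕜) (v : ι × n → 𝕜) (x : ι) :
    gfib (H.hop U *ᵥ v) x = ∑ j, (graphW H x j : 𝕜) • graphT U x j (gfib v (graphNbr H x j)) := by
  classical
  ext i
  simp only [gfib, WithLp.ofLp_toLp, WithLp.ofLp_sum, WithLp.ofLp_smul, Finset.sum_apply, Pi.smul_apply, smul_eq_mul]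
  rw [Hopping.hop, Matrix.sum_mulVec, Finset.sum_apply, Fintype.sum_prod_type]
  refine Finset.sum_congr rfl fun b _ => ?_
  simp only [Fintype.sum_bool, graphW, graphT, graphNbr, if_true, Bool.false_eq_true, if_false, Matrix.smul_mulVec, Matrix.add_mulVec, Pi.smul_apply, Pi.add_apply,
    placed_mulVec_apply, smul_eq_mul, Matrix.toLpLin_apply, WithLp.ofLp_toLp]
  rw [mul_add]
  congr 1 <;> split_ifs <;> simp

/-- ★ THE COVARIANT EQUATION IN KATO FORM: `M_Uv = f` with `c_x = m² + rowSum_x` ⟹ `Σ_j graphW x j·(v_x − T_jv_{nbr}) + m²v_x = f_x`.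
[cite: Balaban1985BackgroundPropagators, (3.23) p.394; DodziukMathai2006, §1] -/
theorem gfib_eq_of_coupling_mulVec (H : Hopping ι β) {m2 : ℝ} (hc : ∀ x, H.c x = m2 + H.rowSum x) (U : β → Matrix n n 𝕜) {v f : ι × n → 𝕜}
    (hv : H.coupling U *ᵥ v = f) (x : ι) :
    ∑ j, (graphW H x j : 𝕜) • (gfib v x - graphT U x j (gfib v (graphNbr H x j))) + (m2 : 𝕜) • gfib v x = gfib f x := by
  have hx : gfib f x = gfib (H.coupling U *ᵥ v) x := by rw [hv]
  rw [hx, Hopping.coupling, sub_mulVec]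
  have hsplit : gfib ((diagonal fun p : ι × n => (H.c p.1 : 𝕜)) *ᵥ v - H.hop U *ᵥ v) x = ((H.c x : ℝ) : 𝕜) • gfib v x - gfib (H.hop U *ᵥ v) x := by
    ext i; simp [gfib, mulVec_diagonal, RCLike.real_smul_eq_coe_mul]
  rw [hsplit, gfib_hop_mulVec, hc x, ← sum_graphW]
  simp only [smul_sub, Finset.sum_sub_distrib, RCLike.ofReal_add, RCLike.ofReal_sum, add_smul, Finset.sum_smul]
  abel

omit [Fintype n] [DecidableEq n] in
/-- The scalar comparison operator on a vector: `(M₀φ)_x = c_xφ_x − Σ_yt_{xy}φ_y`. [folklore] -/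
theorem scalarCoupling_mulVec_apply (H : Hopping ι β) (φ : ι → ℝ) (x : ι) :
    (scalarCoupling H *ᵥ φ) x = H.c x * φ x - ∑ j, graphW H x j * φ (graphNbr H x j) := by
  rw [scalarCoupling, sub_mulVec, Pi.sub_apply, mulVec_diagonal]
  congr 1
  simp only [Matrix.mulVec, dotProduct, Hopping.weightMatrix, Matrix.of_apply, Finset.sum_mul, add_mul]
  rw [Finset.sum_comm, Fintype.sum_prod_type]
  refine Finset.sum_congr rfl fun b _ => ?_
  simp only [Fintype.sum_bool, graphW, graphNbr, if_true, Bool.false_eq_true, if_false, Finset.sum_add_distrib]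
  congr 1
  · by_cases h : H.src b = x
    · simp only [h, true_and, if_true, ite_mul, zero_mul]
      rw [Finset.sum_ite_eq Finset.univ (H.tgt b), if_pos (Finset.mem_univ _)]
    · simp [h]
  · by_cases h : H.tgt b = x
    · simp only [h, true_and, if_true, ite_mul, zero_mul]
      rw [Finset.sum_ite_eq Finset.univ (H.src b), if_pos (Finset.mem_univ _)]
    · simp [h]

omit [Fintype n] [DecidableEq n] in
/-- ★ THE SCALAR EQUATION IN KATO FORM: `M₀φ = g` with `c_x = m² + rowSum_x` ⟹ `Σ_j graphW x j·(φ_x − φ_{nbr}) + m²φ_x = g_x`. [cite: DodziukMathai2006, Lemma 1.1 §1] -/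
theorem scalar_eq_of_scalarCoupling_mulVec (H : Hopping ι β) {m2 : ℝ} (hc : ∀ x, H.c x = m2 + H.rowSum x) {φ g : ι → ℝ}
    (hφ : scalarCoupling H *ᵥ φ = g) (x : ι) : ∑ j, graphW H x j * (φ x - φ (graphNbr H x j)) + m2 * φ x = g x := by
  rw [← hφ, scalarCoupling_mulVec_apply, hc x, ← sum_graphW]
  simp only [mul_sub, Finset.sum_sub_distrib, add_mul, Finset.sum_mul]
  ring

/-! ## §2 Invertibility and domination -/

variable (H : Hopping ι β) {m2 : ℝ}

/-- ★ `M₀` IS INJECTIVE (hence invertible) for `w ≥ 0`, `c_x = m² + rowSum_x`, `m² > 0` — by the maximum principle (the tree's `eq_zero_of_resolvent_zero`), no spectral input.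
[cite: DodziukMathai2006, Lemma 1.1 §1] -/
theorem scalarCoupling_mulVec_injective (hw : ∀ b, 0 ≤ H.w b) (hc : ∀ x, H.c x = m2 + H.rowSum x) (hm : 0 < m2) : Function.Injective (scalarCoupling H).mulVec := by
  intro φ ψ h
  have h0 : scalarCoupling H *ᵥ (φ - ψ) = 0 := by rw [Matrix.mulVec_sub, h, sub_self]
  have hz := eq_zero_of_resolvent_zero (𝕜 := ℝ) (V := ℝ) (graphNbr H) (graphW H) (graphW_nonneg H hw) (fun _ _ => LinearMap.id) (fun _ _ v => le_rfl) hm (u := φ - ψ)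
    (fun x => by simpa only [LinearMap.id_apply, smul_eq_mul, RCLike.ofReal_real_eq_id, id_eq, Pi.zero_apply] using scalar_eq_of_scalarCoupling_mulVec H hc h0 x)
  exact sub_eq_zero.mp hz

/-- `M₀` is invertible. [cite: DodziukMathai2006, Lemma 1.1 §1] -/
theorem isUnit_scalarCoupling (hw : ∀ b, 0 ≤ H.w b) (hc : ∀ x, H.c x = m2 + H.rowSum x) (hm : 0 < m2) : IsUnit (scalarCoupling H) :=
  Matrix.mulVec_injective_iff_isUnit.mp (scalarCoupling_mulVec_injective H hw hc hm)

omit [Fintype ι] in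
/-- Strict dominance from the free-boundary convention. [folklore] -/
theorem strictDom_of_neumann (hw : ∀ b, 0 ≤ H.w b) (hc : ∀ x, H.c x = m2 + H.rowSum x) (hm : 0 < m2) : H.StrictDom :=
  ⟨hw, fun x => by rw [hc x]; linarith⟩

/-- `M_U` is invertible for unitary `U` (tree `posDef_coupling`). [cite: Balaban1982Higgs2, (3.38) p.591] -/
theorem isUnit_coupling (hw : ∀ b, 0 ≤ H.w b) (hc : ∀ x, H.c x = m2 + H.rowSum x) (hm : 0 < m2) {U : β → Matrix n n 𝕜} (hU : ∀ b, U b ∈ Matrix.unitaryGroup n 𝕜) :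
    IsUnit (H.coupling U) :=
  (H.posDef_coupling (strictDom_of_neumann H hw hc hm) hU).isUnit

/-- ★★★ **KATO DOMINATION ON AN ARBITRARY FINITE GRAPH**: for `w ≥ 0`, `c_x = m² + rowSum_x`, `m² > 0` and EVERY unitary link field `U`, if `‖f_x‖_{𝕜ⁿ} ≤ g_x` for all sites then
`‖(M_U⁻¹f)_x‖_{𝕜ⁿ} ≤ (M₀⁻¹g)_x` for all sites (`M_U = H.coupling U`, `M₀ = diag c − t`).  King's regions `Ω` with free boundary conditions (p.670) and the torus (Ͱ-b) are instances.
[cite: DodziukMathai2006, Thm 1.5 + Remark 1.6 §1; King1986, §4 p.670 l.8–13; Balaban1985BackgroundPropagators, (3.23)∕(3.24) p.394] -/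
theorem norm_gfib_coupling_inv_mulVec_le (hw : ∀ b, 0 ≤ H.w b) (hc : ∀ x, H.c x = m2 + H.rowSum x) (hm : 0 < m2)
    {U : β → Matrix n n 𝕜} (hU : ∀ b, U b ∈ Matrix.unitaryGroup n 𝕜) {f : ι × n → 𝕜} {g : ι → ℝ} (hfg : ∀ x, ‖gfib f x‖ ≤ g x) (x : ι) :
    ‖gfib ((H.coupling U)⁻¹ *ᵥ f) x‖ ≤ ((scalarCoupling H)⁻¹ *ᵥ g) x := by
  have hdet : IsUnit (H.coupling U).det := (Matrix.isUnit_iff_isUnit_det _).mp (isUnit_coupling H hw hc hm hU)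
  have hdet0 : IsUnit (scalarCoupling H).det := (Matrix.isUnit_iff_isUnit_det _).mp (isUnit_scalarCoupling H hw hc hm)
  have hv : H.coupling U *ᵥ ((H.coupling U)⁻¹ *ᵥ f) = f := by rw [mulVec_mulVec, Matrix.mul_nonsing_inv _ hdet, one_mulVec]
  have hφ : scalarCoupling H *ᵥ ((scalarCoupling H)⁻¹ *ᵥ g) = g := by rw [mulVec_mulVec, Matrix.mul_nonsing_inv _ hdet0, one_mulVec]
  exact norm_le_scalar_of_resolvent (graphNbr H) (graphW H) (graphW_nonneg H hw) (graphT U) (norm_graphT_le hU) hm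
    (gfib_eq_of_coupling_mulVec H hc U hv) (scalar_eq_of_scalarCoupling_mulVec H hc hφ) hfg x

/-- ★★ **SUP→SUP**: `‖(M_U⁻¹f)_x‖ ≤ sup‖f‖∕m²` on any graph, any unitary `U`. [cite: DodziukMathai2006, Lemma 1.1 §1; Balaban1985BackgroundPropagators, (3.39) p.397] -/
theorem norm_gfib_coupling_inv_mulVec_le_div_mass (hw : ∀ b, 0 ≤ H.w b) (hc : ∀ x, H.c x = m2 + H.rowSum x) (hm : 0 < m2)
    {U : β → Matrix n n 𝕜} (hU : ∀ b, U b ∈ Matrix.unitaryGroup n 𝕜) {f : ι × n → 𝕜} {F : ℝ} (hF : ∀ y, ‖gfib f y‖ ≤ F) (x : ι) :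
    ‖gfib ((H.coupling U)⁻¹ *ᵥ f) x‖ ≤ F / m2 := by
  have hdet : IsUnit (H.coupling U).det := (Matrix.isUnit_iff_isUnit_det _).mp (isUnit_coupling H hw hc hm hU)
  have hv : H.coupling U *ᵥ ((H.coupling U)⁻¹ *ᵥ f) = f := by rw [mulVec_mulVec, Matrix.mul_nonsing_inv _ hdet, one_mulVec]
  exact norm_le_of_resolvent (graphNbr H) (graphW H) (graphW_nonneg H hw) (graphT U) (norm_graphT_le hU) hm (gfib_eq_of_coupling_mulVec H hc U hv) hF x

/-- `M₀⁻¹ ≥ 0` entrywise (the scalar maximum principle). [cite: DodziukMathai2006, Lemma 1.1 §1] -/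
theorem scalarCoupling_inv_nonneg (hw : ∀ b, 0 ≤ H.w b) (hc : ∀ x, H.c x = m2 + H.rowSum x) (hm : 0 < m2) (x y : ι) : 0 ≤ (scalarCoupling H)⁻¹ x y := by
  have hdet0 : IsUnit (scalarCoupling H).det := (Matrix.isUnit_iff_isUnit_det _).mp (isUnit_scalarCoupling H hw hc hm)
  have hφ : scalarCoupling H *ᵥ ((scalarCoupling H)⁻¹ *ᵥ Pi.single y 1) = Pi.single y 1 := by
    rw [mulVec_mulVec, Matrix.mul_nonsing_inv _ hdet0, one_mulVec]
  have h := scalar_nonneg_of_resolvent (graphNbr H) (graphW H) (graphW_nonneg H hw) hm (scalar_eq_of_scalarCoupling_mulVec H hc hφ)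
    (fun z => by simp only [Pi.single_apply]; split_ifs <;> norm_num) x
  simpa only [mulVec_single_one, Matrix.col_apply] using h

omit [Fintype ι] [DecidableEq n] in
/-- The fibre of a point source. [folklore] -/
theorem norm_gfib_pointSource (y : ι) (e : n → 𝕜) (x : ι) :
    ‖gfib (fun p : ι × n => if p.1 = y then e p.2 else 0) x‖ = (if x = y then 1 else 0) * ‖toLp 2 e‖ := by
  by_cases hxy : x = y
  · rw [if_pos hxy, one_mul]; congr 1; ext i; simp [gfib, hxy]
  · rw [if_neg hxy, zero_mul, norm_eq_zero]; ext i; simp [gfib, hxy]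

omit [DecidableEq n] in
/-- The fibre at `x` of `G(δ_y ⊗ e)` is `G_{xy}e`. [folklore] -/
theorem gfib_mulVec_pointSource (G : Matrix (ι × n) (ι × n) 𝕜) (y : ι) (e : n → 𝕜) (x : ι) :
    gfib (G *ᵥ fun p : ι × n => if p.1 = y then e p.2 else 0) x = toLp 2 (blk G x y *ᵥ e) := by
  ext i
  simp only [gfib, WithLp.ofLp_toLp, Matrix.mulVec, dotProduct, blk, Matrix.of_apply]
  rw [Fintype.sum_prod_type, Finset.sum_eq_single y (fun z _ hz => by simp [hz]) (fun h => absurd (Finset.mem_univ _) h)]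
  simp only [if_true]

/-- ★★★ **BLOCKWISE DOMINATION ON ANY GRAPH**: `‖(M_U⁻¹)_{xy}e‖ ≤ M₀⁻¹(x,y)·‖e‖`. [cite: DodziukMathai2006, Thm 1.5 §1; King1986, §4 p.670] -/
theorem norm_blk_coupling_inv_mulVec_le (hw : ∀ b, 0 ≤ H.w b) (hc : ∀ x, H.c x = m2 + H.rowSum x) (hm : 0 < m2)
    {U : β → Matrix n n 𝕜} (hU : ∀ b, U b ∈ Matrix.unitaryGroup n 𝕜) (x y : ι) (e : n → 𝕜) :
    ‖toLp 2 (blk ((H.coupling U)⁻¹) x y *ᵥ e)‖ ≤ (scalarCoupling H)⁻¹ x y * ‖toLp 2 e‖ := by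
  have h := norm_gfib_coupling_inv_mulVec_le H hw hc hm hU (f := fun p : ι × n => if p.1 = y then e p.2 else 0)
    (g := fun z => (if z = y then 1 else 0) * ‖toLp 2 e‖) (fun z => (norm_gfib_pointSource y e z).le) x
  have hcol : ((scalarCoupling H)⁻¹ *ᵥ fun z => (if z = y then (1 : ℝ) else 0) * ‖toLp 2 e‖) x = (scalarCoupling H)⁻¹ x y * ‖toLp 2 e‖ := by
    have : (fun z : ι => (if z = y then (1 : ℝ) else 0) * ‖toLp 2 e‖) = Pi.single y ‖toLp 2 e‖ := by
      funext z; simp only [Pi.single_apply, ite_mul, one_mul, zero_mul]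
    rw [this, mulVec_single]; simp [Matrix.col_apply]
  rwa [gfib_mulVec_pointSource, hcol] at h

/-- ★★★ **ENTRYWISE DOMINATION ON ANY GRAPH**: `|M_U⁻¹((x,i),(y,j))| ≤ M₀⁻¹(x,y)` for every unitary link field. [cite: DodziukMathai2006, Thm 1.5 §1; King1986, §4 p.670] -/
theorem norm_coupling_inv_entry_le (hw : ∀ b, 0 ≤ H.w b) (hc : ∀ x, H.c x = m2 + H.rowSum x) (hm : 0 < m2)
    {U : β → Matrix n n 𝕜} (hU : ∀ b, U b ∈ Matrix.unitaryGroup n 𝕜) (x y : ι) (i j : n) :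
    ‖(H.coupling U)⁻¹ (x, i) (y, j)‖ ≤ (scalarCoupling H)⁻¹ x y := by
  have h := norm_blk_coupling_inv_mulVec_le H hw hc hm hU x y (Pi.single j 1)
  rw [mulVec_single_one, PiLp.toLp_single, PiLp.norm_single, norm_one, mul_one] at h
  refine le_trans ?_ h
  have := PiLp.norm_apply_le (toLp 2 ((blk ((H.coupling U)⁻¹) x y).col j)) i
  simpa only [PiLp.toLp_apply, Matrix.col_apply, blk, Matrix.of_apply] using this

/-! ## §3 The torus instance recovered -/

section Torus

variable {d : ℕ} (K : Fin (d + 1) → ℕ) [hK : ∀ μ, NeZero (K μ)]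

/-- The weight matrix of the King datum is Ͱ-k's hopping matrix: `weightMatrix(kingHopping) = kingHop K c`. [cite: King1986, (4.4) p.670] -/
theorem weightMatrix_kingHopping (c m2 : ℝ) : (kingHopping K c m2).weightMatrix = kingHop K c := by
  ext x y
  simp only [Hopping.weightMatrix, Matrix.of_apply, kingHopping, kingHop]
  rw [Fintype.sum_prod_type, Finset.sum_comm, Finset.mul_sum]
  refine Finset.sum_congr rfl fun μ _ => ?_
  rw [Finset.sum_add_distrib, mul_add]
  congr 1
  · simp only [ite_and]
    rw [Finset.sum_ite_eq' Finset.univ x, if_pos (Finset.mem_univ _)]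
    split_ifs <;> simp_all [eq_comm]
  · have hiff : ∀ z : Tor K, (z + unitVec K μ = x ∧ z = y) ↔ (z = y ∧ y = x - unitVec K μ) := fun z => by
      constructor
      · rintro ⟨h1, rfl⟩; exact ⟨rfl, eq_sub_of_add_eq h1⟩
      · rintro ⟨rfl, h2⟩; exact ⟨by rw [h2, sub_add_cancel], rfl⟩
    simp only [hiff, ite_and]
    rw [Finset.sum_ite_eq' Finset.univ y, if_pos (Finset.mem_univ _)]
    split_ifs <;> simp

/-- ★ THE SCALAR COMPARISON OPERATOR OF THE KING DATUM IS KING's `c(−Δ)+m²`: `scalarCoupling(kingHopping K c m²) = lapF K c m²`. [cite: King1986, (4.4) p.670] -/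
theorem scalarCoupling_kingHopping (c m2 : ℝ) : scalarCoupling (kingHopping K c m2) = lapF K c m2 := by
  rw [scalarCoupling, weightMatrix_kingHopping, lapF_eq_sub_kingHop]
  congr 1
  ext x y
  simp only [diagonal_apply, kingHopping, Matrix.smul_apply, Matrix.one_apply, smul_eq_mul, mul_ite, mul_one, mul_zero]

/-- The King datum satisfies the free-boundary convention with mass `m²`. [cite: King1986, (4.4) p.670] -/
theorem kingHopping_neumann (c m2 : ℝ) (x : Tor K) : (kingHopping K c m2).c x = m2 + (kingHopping K c m2).rowSum x := by
  rw [kingHopping_rowSum]; rfl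

/-- Consistency: §2 at `H = kingHopping` is PART Ͱ-b's torus domination `|G_U((x,i),(y,j))| ≤ (lapF K c m²)⁻¹(x,y)`. [cite: King1986, (4.4) p.670; DodziukMathai2006, Thm 1.5 §1] -/
theorem norm_covLapF_inv_entry_le_again {c m2 : ℝ} (hc : 0 ≤ c) (hm : 0 < m2) {U : Tor K × Fin (d + 1) → Matrix n n 𝕜}
    (hU : ∀ b, U b ∈ Matrix.unitaryGroup n 𝕜) (x y : Tor K) (i j : n) : ‖(covLapF K c m2 U)⁻¹ (x, i) (y, j)‖ ≤ (lapF K c m2)⁻¹ x y := by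
  rw [← scalarCoupling_kingHopping K c m2]
  exact norm_coupling_inv_entry_le (kingHopping K c m2) (fun _ => hc) (kingHopping_neumann K c m2) hm hU x y i j

end Torus

end Summit.QuantumFields.YangMills.BalabanUVNodes.N15KingModelRung.Covariant

end
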